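import Summits.FinalStateConjecture.FinalStateConjecture.Theses.StarvedNecks
import Summits.FinalStateConjecture.FinalStateConjecture.Theses.TangentConeAtIPlus
import Summits.FinalStateConjecture.FinalStateConjecture.Theses.GlobalAttraction
import Summits.FinalStateConjecture.FinalStateConjecture.Theorems.StarvedNecksSeamedChartsExhaust
import Summits.FinalStateConjecture.FinalStateConjecture.Theorems.StarvedNecksFutureOrientedOfSeamed
import HarnessLib

/-!
# Skeleton — crux stmt-FinalStateConjecture-17575 `Theses.StarvedNecks.HonestFixedRadiusSettlingT` (= T),
# ALTERNATIVE line `censor_attract_upgrade` (crux-strategist s2, 2026-08-17) — "censorship | attraction | regularity"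

The live line `Sketch` (lead c5) isolates ONE dynamical stub `stub_coreKick` which is, kernel-checked
(`Theorems.StarvedNecks.CoreReduction.T_iff_coreKick`, p138197), the whole rays-less crux: tame-generic weak cosmic
censorship + finitely many sub-extremal Kerr final states with honest fixed-radius `C⁴` charts, at once.  The monolith is
forced by ONE fact: tame Christodoulou genericity is not closed under `∧`, so every clause placed under the genericity
quantifier must be re-witnessed along the SAME curve.

This line removes every SETTLING claim from under the genericity quantifier.  The only generic stub,
`stub_genericCleanCensorship`, asserts censorship + far-cleanliness + two UNIVERSAL label clauses (third law, read on honest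
fixed-radius `C⁰` configurations; non-parabolic recession, read on honest fixed-radius `C⁴` configurations, T's own format) — it
never asserts that a chart exists.  All chart
existence is DETERMINISTIC and CONDITIONAL: `stub_censoredFixedRadiusSettle` is literally route GlobalAttraction's item
stmt-17684 (Komech-type attraction of EVERY censored MGHD to the Kerr family, `C⁰`, `|aᵢ| ≤ Mᵢ`, in T's own honesty
bundles), and `stub_honestRegularityUpgrade` is the red-shift regularity step `C⁰ → C⁴` for sub-extremal configurations of
FAR-CLEAN data (cousin of GlobalAttraction.SubextremalUpgrade stmt-17298 in T's format; Aretakis and the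
`k = 4` far-roughness liability L1 are evaded by hypothesis).  The composition is `mono` (antitonicity of tame genericity in
the exceptional set, verbatim the route's `closes`) over the POINTWISE implication

  FarClean(D) ∧ CensoredLabels(D)  ⟹  Pnr(D)      (17684, then the C⁰ third-law clause, then the upgrade, then the C⁴ recession clause),

followed by the tail of line `Sketch` (lever of card `rays-see-only-o`): S = `stub_necksCertifyR` (item 17574) re-seams the
`C⁴` witness into a `C²` HonestCore ∧ SEAMED decomposition of the SAME `O`, E (landed p128314) and F (item 17576, landed)
decorate it, `stub_settledExteriorHoldsRays` (item 17673) returns `RaysStayInClosure 𝒟 O`, and the `C⁴` witness is re-used.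

Stubs (5): `stub_genericCleanCensorship` (GENERIC; ⊇ item 17269 tame WCC; nearest item 17297
`GlobalAttraction.GenericCensorshipThirdLaw` = the same property read on exhaustive `C⁰` configurations, without the
velocity clause and without far-cleanliness of the members), `stub_censoredFixedRadiusSettle` (= item 17684, delegated),
`stub_honestRegularityUpgrade` (DETERMINISTIC, new), `stub_necksCertifyR` (= item 17574, delegated),
`stub_settledExteriorHoldsRays` (= item 17673, delegated).  `HonestFixedRadiusSettlingT_of` concludes the crux BY NAME.

Disproof used (Cruxes/HonestFixedRadiusSettlingT/Disproof.lean v4): `settlesHonestlyT_false_without_isMaximal` — every stub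
keeps the guard `𝒟.IsMaximal →` (17684, the upgrade, the label clause); §5(a)/L1 (`k = 4` fails at far-rough data,
`wDist`-densely) — honoured by putting far-cleanliness INSIDE the generic property (witness curves must clean: broom + kick,
`not_isImmersedAtZero_of_eventuallyEq`) and as a HYPOTHESIS of the deterministic upgrade; §2 `T_false_of_not_tameWCC` —
the generic stub contains tame WCC openly; no stub is an instance of a landed `Negative/*` lemma (FlatClassCensusT,
KillShapeT concern `P_T` at the trivial datum, where every stub here holds or is vacuous).
-/

set_option linter.dupNamespace false

noncomputable section

open scoped Manifold ContDiff ENNReal Topology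
open Filter Set Function Literature.Geometry.Lorentzian

namespace Summit.FinalStateConjecture.FinalStateConjecture.Cruxes.HonestFixedRadiusSettlingT.CensorAttractUpgrade

/-- **stub_genericCleanCensorship** (THE GENERIC STUB — censorship, third law, non-parabolic recession, far-cleanliness;
NO settling claim).  For every admissible `3`-manifold `X`, TAME-Christodoulou-generically in `admissibleVacuumData X`
(codimension `1`): the datum is far-clean to order `(6,5)` on some end (`h = (1+2M/r)δ + o₆(r⁻¹)`, `k = o₅(r⁻²)`), it has
an MGHD, and EVERY MGHD `𝒟` has complete `𝓘⁺` (sojourn form) AND (third law, read at `C⁰`) every honest fixed-radius `C⁰`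
configuration of it — `(O, d : FinalStateDecomposition … O 0, R₀)` with `O = exteriorOf 𝒟 d.charted`, `RaysStayInClosure 𝒟 O`,
`IsFutureOriented d`, `Hc0(d, R₀)` (T's HonestCore WITHOUT sub-extremality: `100 Mᵢ ≤ R₀`, orthochronous boosts,
anchoring, relative closedness, future-oriented flat chart) and `Hf(d, R₀)` (T's HonestFar) — has ONLY sub-extremal holes
`|aᵢ| < Mᵢ`, AND (recession, read at `C⁴`, T's own format) every honest fixed-radius `C⁴` configuration
`(O, d : FinalStateDecomposition … O 4, R₀)` with `O = exteriorOf`, `Hc(d, R₀)`, `Hf(d, R₀)` has pairwise DISTINCT asymptotic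
four-velocities.  In words: weak cosmic censorship, the third law
("extremal remnants only from positive-codimension data", Kehle–Unger arXiv:2402.10190 / KehleUnger2025 as the model) and
"parabolic (comoving) final pairs only from positive-codimension data" (cards late-pair-kick / repulsive-quadratic-kicks;
`ComovingPairWitness` p73407), conjoined ON ONE EXCEPTIONAL SET with far-cleanliness of the witness members (liability L1:
brooms + kicks, Disproof §5(a), `stub_farCleaning` of line Sketch is its elliptic part).  Nearest item: 17297
`GlobalAttraction.GenericCensorshipThirdLaw` (same shape, read on EXHAUSTIVE `C⁰` configurations, no velocity clause, no
cleanliness).  Contains item 17269 (tame WCC).  OPEN PROBLEM (censorship); the label clauses are threshold-transversality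
statements.  Why it might fail: censorship itself; a tame-STABLE extremal or parabolic threshold (Kehle–Unger / Chazy
thresholds of codimension 0); a spurious honest `C⁰` configuration modelled on an extremal Kerr at a sub-extremally
settling development (label rigidity at `C⁰`); cleaning that cannot preserve censorship at a rough censored datum. -/
theorem stub_genericCleanCensorship : open Literature.Geometry.Lorentzian in open scoped ContDiff ENNReal in let Hc0 := (fun (𝓢 : Spacetime.{0} 4) (O : Set 𝓢.carrier) (k : ℕ) (d : FinalStateDecomposition 𝓢 O k) (R₀ : ℝ) => let B := d.background; let t := fun i ↦ (B i).time; let r := fun i ↦ (B i).radius; let Ψ := d.chart; (∀ i, 100 * d.mass i ≤ R₀ ∧ 0 < ((d.motion i).1 : E4 ≃L[ℝ] E4) (E4.basisVector 0) 0) ∧ (∀ i (ϱ τ₂ : ℝ), R₀ ≤ ϱ → d.τ₀ < τ₂ → Ψ i '' {x | d.τ₀ < t i x.1 ∧ t i x.1 < τ₂ ∧ r i x.1 < ϱ} ⊆ 𝓢.metric.causalPast 𝓢.timeOrientation (Ψ i '' (B i).truncTimeSlab ϱ τ₂)) ∧ (∀ i (τ' : ℝ) (ϱ : ℝ → ℝ),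 Continuous ϱ → d.τ₀ < τ' → let A := Ψ i '' {x | τ' ≤ t i x.1 ∧ r i x.1 ≤ ϱ (t i x.1)}; closure A ∩ O ⊆ A) ∧ (∀ y : d.flatDomain, d.τ₀ < y.1 0 → 𝓢.timeOrientation.IsFutureDirected (mfderiv 𝓘(ℝ, E4) (𝓡 4) d.flatChart y (E4.basisVector 0)))); let Hc := ( fun (𝓢 : Spacetime.{0} 4) (O : Set 𝓢.carrier) (k : ℕ) (d : FinalStateDecomposition 𝓢 O k) (R₀ : ℝ) => let B := d.background; let t := fun i ↦ (B i).time; let r := fun i ↦ (B i).radius; let Ψ := d.chart; (∀ i, Kerr.IsSubextremal (d.mass i) (d.spin i) ∧ 100 * d.mass i ≤ R₀ ∧ 0 < ((d.motion i).1 : E4 ≃L[ℝ] E4) (E4.basisVector 0) 0) ∧ (∀ i (ϱ τ₂ : ℝ), R₀ ≤ ϱ → d.τ₀ < τ₂ → Ψ i '' {x | d.τ₀ < t i x.1 ∧ t i x.1 < τ₂ ∧ r i x.1 < ϱ} ⊆ 𝓢.metric.causalPast 𝓢.timeOrientation (Ψ i '' (B i).truncTimeSlab ϱ τ₂)) ∧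 (∀ i (τ' : ℝ) (ϱ : ℝ → ℝ), Continuous ϱ → d.τ₀ < τ' → let A := Ψ i '' {x | τ' ≤ t i x.1 ∧ r i x.1 ≤ ϱ (t i x.1)}; closure A ∩ O ⊆ A) ∧ (∀ y : d.flatDomain, d.τ₀ < y.1 0 → 𝓢.timeOrientation.IsFutureDirected (mfderiv 𝓘(ℝ, E4) (𝓡 4) d.flatChart y (E4.basisVector 0))) ); let Hf := ( fun (𝓢 : Spacetime.{0} 4) (O : Set 𝓢.carrier) (k : ℕ) (d : FinalStateDecomposition 𝓢 O k) (R₀ : ℝ) => let B := d.background; let t := fun i ↦ (B i).time; let r := fun i ↦ (B i).radius; let Φ := d.flatChart; (∀ τ₂ : ℝ, d.τ₀ < τ₂ → Φ '' {y | d.τ₀ < y.1 0 ∧ y.1 0 < τ₂} ⊆ 𝓢.metric.causalPast 𝓢.timeOrientation (Φ '' (Minkowski.backgroundOn d.flatDomain).timeSlab τ₂)) ∧ (∀ τ' : ℝ, d.τ₀ < τ' → closure (Φ '' {y | τ' ≤ y.1 0 ∧ ∀ i, d.excision i (y.1 0) + 1 ≤ r i y.1}) ⊆ Φ '' {y | τ'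 ≤ y.1 0}) ∧ (∀ i, ∃ T : ℝ, supCkENorm (Subtype.val '' {x : (B i).domain | T ≤ t i x.1 ∧ R₀ ≤ r i x.1 ∧ ∀ j, j ≠ i → r i x.1 ≤ r j x.1}) 0 (𝓢.deviationExtend (B i) (d.chart i)) ≤ ENNReal.ofReal (1 / (10 * ‖(((d.motion i).1 : E4 ≃L[ℝ] E4) : E4 →L[ℝ] E4)‖ ^ 2))) ); ∀ (X : Type) [TopologicalSpace X] [ChartedSpace E3 X] [IsManifold (𝓡 3) ∞ X] [T2Space X] [SecondCountableTopology X] [ConnectedSpace X], InitialDataSet.IsTameChristodoulouGeneric (admissibleVacuumData X) (fun D ↦ (∃ (e : AFEnd X) (M : ℝ), e.IsStronglyAsymptoticallyFlatWith D M 1 2 6 5) ∧ (∃ 𝒟 : VacuumCauchyDevelopment D, 𝒟.IsMaximal) ∧ ∀ 𝒟 : VacuumCauchyDevelopment D, 𝒟.IsMaximal → HasCompleteNullInfinity 𝒟.toCauchyDevelopment ∧ (∀ (O : Set 𝒟.carrier) (d : FinalStateDecomposition 𝒟.toSpacetime O 0) (R₀ : ℝ), O = exteriorOf 𝒟.toCauchyDevelopment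 d.charted → RaysStayInClosure 𝒟.toCauchyDevelopment O → IsFutureOriented d → Hc0 𝒟.toSpacetime O 0 d R₀ → Hf 𝒟.toSpacetime O 0 d R₀ → ∀ i, Kerr.IsSubextremal (d.mass i) (d.spin i)) ∧ (∀ (O : Set 𝒟.carrier) (d : FinalStateDecomposition 𝒟.toSpacetime O 4) (R₀ : ℝ), O = exteriorOf 𝒟.toCauchyDevelopment d.charted → Hc 𝒟.toSpacetime O 4 d R₀ → Hf 𝒟.toSpacetime O 4 d R₀ → (∀ i j : Fin d.N, i ≠ j → ((d.motion i).1 : E4 ≃L[ℝ] E4) (E4.basisVector 0) ≠ ((d.motion j).1 : E4 ≃L[ℝ] E4) (E4.basisVector 0)))) 1 := by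
  sorry

/-- **stub_censoredFixedRadiusSettle** — DELEGATED: literally item stmt-FinalStateConjecture-17684
`Theses.GlobalAttraction.CensoredFixedRadiusSettle` (route GlobalAttraction, crux r2; child X₁ of the strategist split of
`CensoredExteriorsSettle` 17296; registered skeleton `Cruxes/CensoredExteriorsSettle/Lines/neck_split.lean`): KOMECH-TYPE
ATTRACTION, deterministic, all censored data, `C⁰`, `|aᵢ| ≤ Mᵢ` — every MGHD with complete `𝓘⁺` of an admissible datum
carries `(O, d : FinalStateDecomposition … O 0, R₀)` with `O = exteriorOf`, `RaysStayInClosure`, `IsFutureOriented`,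
`Hc0 ∧ Hf`.  Never worked inside this line. -/
theorem stub_censoredFixedRadiusSettle : Theses.GlobalAttraction.CensoredFixedRadiusSettle := by
  sorry

/-- **stub_honestRegularityUpgrade** (DETERMINISTIC, new; the red-shift regularity step in T's format).  For every
admissible datum `D` that is FAR-CLEAN to order `(6,5)` on some end, every MGHD `𝒟` with complete `𝓘⁺`, and every honest
fixed-radius `C⁰` configuration `(O₀, d₀, R₀)` of `𝒟` (`O₀ = exteriorOf 𝒟 d₀.charted`, `RaysStayInClosure`,
`IsFutureOriented d₀`, `Hc0`, `Hf`) ALL of whose holes are SUB-extremal, there is an honest fixed-radius `C⁴` configuration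
`(O, d : FinalStateDecomposition … O 4, R₁)` of the same development: `O = exteriorOf 𝒟 d.charted`, `Hc(d, R₁)` (T's HonestCore,
sub-extremal holes), `Hf(d, R₁)` — pure regularity, no velocity bookkeeping.  Intended proof: keep the holes and labels of `d₀`; eventual uniform red-shift of the sub-extremal horizons
(κ → κ_∞ > 0) and elliptic–hyperbolic regularity of the vacuum equations on the fixed-radius slabs upgrade `C⁰`-closeness to
`C⁴`-closeness (smooth data; DafermosRodnianski arXiv:0811.0354 §3–§7 red-shift vector field; arXiv:1402.7034 Cor. 3.1 as cited by
route GlobalAttraction — transversal derivatives decay on sub-extremal horizons; GKS arXiv:2205.14808 for the near-Kerr regime); the flat chart is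
rebuilt in the same class; far-cleanliness makes the incoming far field invisible in unweighted `C⁴` sups at fixed radius
(fixed-radius `m`-th derivatives of the focused tail are `o(t^{-m})`, `m ≤ 6`, Disproof §6), which is exactly what the
`wDist`-dense far-rough trains of Disproof §5(a) deny for general admissible data.  Cousin of item 17298
`GlobalAttraction.SubextremalUpgrade` (`C⁰ → C²`, exhaustive format).  Why it might fail: `C⁰` closeness in SOME chart gives
no derivative control — a censored exterior parking small-amplitude HIGH-FREQUENCY content at the photon sphere or in the
necks (Burnett-type, arXiv:2009.08968; refocused Luk–Oh tails arXiv:2404.02220) would be `C⁰`- but not `C⁴`-settled at a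
fixed radius; the honesty clauses (anchoring C2, closedness C3, Voronoi `C⁰` honesty F3) must survive the chart rebuild. -/
theorem stub_honestRegularityUpgrade : open Literature.Geometry.Lorentzian in open scoped ContDiff ENNReal in let Hc0 := (fun (𝓢 : Spacetime.{0} 4) (O : Set 𝓢.carrier) (k : ℕ) (d : FinalStateDecomposition 𝓢 O k) (R₀ : ℝ) => let B := d.background; let t := fun i ↦ (B i).time; let r := fun i ↦ (B i).radius; let Ψ := d.chart; (∀ i, 100 * d.mass i ≤ R₀ ∧ 0 < ((d.motion i).1 : E4 ≃L[ℝ] E4) (E4.basisVector 0) 0) ∧ (∀ i (ϱ τ₂ : ℝ), R₀ ≤ ϱ → d.τ₀ < τ₂ → Ψ i '' {x | d.τ₀ < t i x.1 ∧ t i x.1 < τ₂ ∧ r i x.1 < ϱ} ⊆ 𝓢.metric.causalPast 𝓢.timeOrientation (Ψ i '' (B i).truncTimeSlab ϱ τ₂)) ∧ (∀ i (τ' : ℝ) (ϱ : ℝ → ℝ), Continuous ϱ → d.τ₀ < τ' → let A := Ψ i '' {x | τ' ≤ t i x.1 ∧ r i x.1 ≤ ϱ (t i x.1)}; closure A ∩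 O ⊆ A) ∧ (∀ y : d.flatDomain, d.τ₀ < y.1 0 → 𝓢.timeOrientation.IsFutureDirected (mfderiv 𝓘(ℝ, E4) (𝓡 4) d.flatChart y (E4.basisVector 0)))); let Hc := ( fun (𝓢 : Spacetime.{0} 4) (O : Set 𝓢.carrier) (k : ℕ) (d : FinalStateDecomposition 𝓢 O k) (R₀ : ℝ) => let B := d.background; let t := fun i ↦ (B i).time; let r := fun i ↦ (B i).radius; let Ψ := d.chart; (∀ i, Kerr.IsSubextremal (d.mass i) (d.spin i) ∧ 100 * d.mass i ≤ R₀ ∧ 0 < ((d.motion i).1 : E4 ≃L[ℝ] E4) (E4.basisVector 0) 0) ∧ (∀ i (ϱ τ₂ : ℝ), R₀ ≤ ϱ → d.τ₀ < τ₂ → Ψ i '' {x | d.τ₀ < t i x.1 ∧ t i x.1 < τ₂ ∧ r i x.1 < ϱ} ⊆ 𝓢.metric.causalPast 𝓢.timeOrientation (Ψ i '' (B i).truncTimeSlab ϱ τ₂)) ∧ (∀ i (τ' : ℝ) (ϱ : ℝ → ℝ), Continuous ϱ → d.τ₀ < τ' → let A := Ψ i '' {x | τ' ≤ t i x.1 ∧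 r i x.1 ≤ ϱ (t i x.1)}; closure A ∩ O ⊆ A) ∧ (∀ y : d.flatDomain, d.τ₀ < y.1 0 → 𝓢.timeOrientation.IsFutureDirected (mfderiv 𝓘(ℝ, E4) (𝓡 4) d.flatChart y (E4.basisVector 0))) ); let Hf := ( fun (𝓢 : Spacetime.{0} 4) (O : Set 𝓢.carrier) (k : ℕ) (d : FinalStateDecomposition 𝓢 O k) (R₀ : ℝ) => let B := d.background; let t := fun i ↦ (B i).time; let r := fun i ↦ (B i).radius; let Φ := d.flatChart; (∀ τ₂ : ℝ, d.τ₀ < τ₂ → Φ '' {y | d.τ₀ < y.1 0 ∧ y.1 0 < τ₂} ⊆ 𝓢.metric.causalPast 𝓢.timeOrientation (Φ '' (Minkowski.backgroundOn d.flatDomain).timeSlab τ₂)) ∧ (∀ τ' : ℝ, d.τ₀ < τ' → closure (Φ '' {y | τ' ≤ y.1 0 ∧ ∀ i, d.excision i (y.1 0) + 1 ≤ r i y.1}) ⊆ Φ '' {y | τ' ≤ y.1 0}) ∧ (∀ i, ∃ T : ℝ, supCkENorm (Subtype.val '' {x : (B i).domain | T ≤ t i x.1 ∧ R₀ ≤ r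 i x.1 ∧ ∀ j, j ≠ i → r i x.1 ≤ r j x.1}) 0 (𝓢.deviationExtend (B i) (d.chart i)) ≤ ENNReal.ofReal (1 / (10 * ‖(((d.motion i).1 : E4 ≃L[ℝ] E4) : E4 →L[ℝ] E4)‖ ^ 2))) ); ∀ (X : Type) [TopologicalSpace X] [ChartedSpace E3 X] [IsManifold (𝓡 3) ∞ X] [T2Space X] [SecondCountableTopology X] [ConnectedSpace X], ∀ D ∈ admissibleVacuumData X, (∃ (e : AFEnd X) (M : ℝ), e.IsStronglyAsymptoticallyFlatWith D M 1 2 6 5) → ∀ 𝒟 : VacuumCauchyDevelopment D, 𝒟.IsMaximal → HasCompleteNullInfinity 𝒟.toCauchyDevelopment → ∀ (O₀ : Set 𝒟.carrier) (d₀ : FinalStateDecomposition 𝒟.toSpacetime O₀ 0) (R₀ : ℝ), O₀ = exteriorOf 𝒟.toCauchyDevelopment d₀.charted → RaysStayInClosure 𝒟.toCauchyDevelopment O₀ → IsFutureOriented d₀ → Hc0 𝒟.toSpacetime O₀ 0 d₀ R₀ → Hf 𝒟.toSpacetime O₀ 0 d₀ R₀ → (∀ i, Kerr.IsSubextremal (d₀.mass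 i) (d₀.spin i)) → ∃ (O : Set 𝒟.carrier) (d : FinalStateDecomposition 𝒟.toSpacetime O 4) (R₁ : ℝ), O = exteriorOf 𝒟.toCauchyDevelopment d.charted ∧ Hc 𝒟.toSpacetime O 4 d R₁ ∧ Hf 𝒟.toSpacetime O 4 d R₁ := by
  sorry

/-- **stub_necksCertifyR** — DELEGATED: item stmt-FinalStateConjecture-17574 (`NecksCertifyR`; in route rev ≥ 6 it is
`GapDecaySuffices` (stmt-18060) applied to `NeckGapDecay` (stmt-16768)); exactly as in line Sketch. -/
theorem stub_necksCertifyR : Theses.StarvedNecks.NecksCertifyR := by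
  sorry

/-- **stub_settledExteriorHoldsRays** — DELEGATED: item stmt-FinalStateConjecture-17673
(`TangentConeAtIPlus.SettledExteriorHoldsRays`, ∀-datum; registered skeleton with stubs
`stub_chartsShadowEndVisibleRegion`, `stub_noHiddenCompleteRays`); exactly as in line Sketch. -/
theorem stub_settledExteriorHoldsRays : Theses.TangentConeAtIPlus.SettledExteriorHoldsRays := by
  sorry

/-- Tame Christodoulou genericity (codimension `1`) is antitone in the exceptional set (verbatim the `mono` step of the
route's `closes` and of line Sketch). [folklore] -/
theorem mono {X : Type} [TopologicalSpace X] [ChartedSpace E3 X] [IsManifold (𝓡 3) ∞ X]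
    {𝓓 : Set (InitialDataSet (𝓡 3) X)} {P Q : InitialDataSet (𝓡 3) X → Prop}
    (hPQ : ∀ D ∈ 𝓓, P D → Q D) (hP : InitialDataSet.IsTameChristodoulouGeneric 𝓓 P 1) :
    InitialDataSet.IsTameChristodoulouGeneric 𝓓 Q 1 := by
  intro d hd
  obtain ⟨e, F, hF, himm, h0, hinj, hmem, hE⟩ := hP d ⟨hd.1, fun h ↦ hd.2 (hPQ d hd.1 h)⟩
  exact ⟨e, F, hF, himm, h0, hinj, hmem, fun c hc hc' ↦ hE c hc ⟨hc'.1, fun h ↦ hc'.2 (hPQ _ hc'.1 h)⟩⟩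

/-- **The crux BY NAME from the five stubs.**  Pointwise on the admissible class: far-clean + censored-with-labels ⟹ the
rays-less property `Pnr` (17684 gives an honest `C⁰` configuration of each MGHD; the `C⁰` third-law clause makes it sub-extremal;
the upgrade makes it `C⁴`-honest; the `C⁴` recession clause makes it non-comoving), and then the tail of line Sketch: S re-seams into `d₂` on the same `O`,
E/F decorate `d₂`, 17673 returns the rays clause for `O`, and the `C⁴` witness is re-used; `mono` transfers genericity. -/
theorem HonestFixedRadiusSettlingT_of : Theses.StarvedNecks.HonestFixedRadiusSettlingT := by
  intro X _ _ _ _ _ _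
  have hS : Theses.StarvedNecks.NecksCertifyR := stub_necksCertifyR
  have hE : Theses.StarvedNecks.SeamedChartsExhaust :=
    Theorems.SeamedChartsExhaust.WideAnchoring.seamedChartsExhaust
  have hF : Theses.StarvedNecks.FutureOrientedOfSeamed :=
    Theorems.FutureOrientedOfSeamed.ClockDualityRays.FutureOrientedOfSeamed_of
  have hR : Theses.TangentConeAtIPlus.SettledExteriorHoldsRays := stub_settledExteriorHoldsRays
  have hA : Theses.GlobalAttraction.CensoredFixedRadiusSettle := stub_censoredFixedRadiusSettle
  have hU := stub_honestRegularityUpgrade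
  refine mono ?_ (stub_genericCleanCensorship X)
  rintro D hD ⟨hclean, hex, hall⟩
  refine ⟨hex, fun 𝒟 h𝒟 ↦ ?_⟩
  obtain ⟨hscri, hsubLab, hdvLab⟩ := hall 𝒟 h𝒟
  -- 17684: an honest fixed-radius C⁰ configuration of this censored MGHD
  obtain ⟨O₀, d₀, R₀, hO₀, hrays₀, hfo₀, hcore₀, hfar₀⟩ := hA X D hD 𝒟 h𝒟 hscri
  -- the generic THIRD-LAW clause (read at C⁰): its holes are sub-extremal
  have hsub₀ : ∀ i, Kerr.IsSubextremal (d₀.mass i) (d₀.spin i) := hsubLab O₀ d₀ R₀ hO₀ hrays₀ hfo₀ hcore₀ hfar₀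
  -- the deterministic upgrade: an honest fixed-radius C⁴ configuration
  obtain ⟨O, d, R₁, hO, hcore, hfar⟩ := hU X D hD hclean 𝒟 h𝒟 hscri O₀ d₀ R₀ hO₀ hrays₀ hfo₀ hcore₀ hfar₀ hsub₀
  -- the generic RECESSION clause (read at C⁴, T's own format): its holes do not comove
  have hdv := hdvLab O d R₁ hO hcore hfar
  -- tail of line Sketch: S re-seams on the same O; E, F decorate d₂; 17673 gives the rays clause; re-use the C⁴ witness
  obtain ⟨d₂, R, R₀', hO₂, hcore₂, hseam⟩ := hS X D hD 𝒟 h𝒟 O d R₁ hO hcore hfar hdv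
  exact ⟨hscri, O, d, R₁, hO,
    hR X D hD 𝒟 h𝒟 hscri O d₂ (fun i ↦ (hcore₂.1 i).1) hO₂
      (hE X D hD 𝒟 h𝒟 O d₂ R R₀' hO₂ hcore₂ hseam) (hF X D hD 𝒟 h𝒟 O d₂ R R₀' hO₂ hcore₂ hseam),
    hcore, hfar, hdv⟩

end Summit.FinalStateConjecture.FinalStateConjecture.Cruxes.HonestFixedRadiusSettlingT.CensorAttractUpgrade

end
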